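import Summits.ResolutionOfSingularities.ResolutionOfSingularities.Theorems.TameCutClasses
import Summits.ResolutionOfSingularities.ResolutionOfSingularities.Theorems.RiderCutKernels
import Literature.AlgebraicGeometry.Resolution.RegularBlowup
import Literature.AlgebraicGeometry.Resolution.BlowupDisjointCentreSplitting
import HarnessLib

/-!
# TameCutKernels — decomp-res node «TameCut» (lens-4 g21) refining the MaxContactCut aside 32260; tree file 2/3 of the node

Content VERBATIM from the decomp-res lens-4 g21 file `HOME/decomp-res-lens-4/g21/TameCut.lean` (sha256 ad77f9303f4ee357 ≡
`parts/TameCut-NODE-ad77f930.lean`, 786 l, written directly against the tree: no copy of earlier generations).  HOME =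
run/shared/lean/pub/decomp-res.  Critic: CRITIC-LEDGER row 134 CLEARED, landing order 2026-08-30T19:16:20Z.

Route-independent, cone-free: §44 THE TAME CONTACT THEOREM along lens-4's `ForcedTower` (hypothesis-free, standard axioms):
`tower_isLocallyNoetherian_isRegular`, `tower_mult_eq`, `tower_stalkIdeal_le_pow`, `tower_absInv_succ`,
`tower_absInv_strictIter`,
`isAbsContactAt_of_tame_sep`, `contactHugging_of_isAbsContactAt_root`, `contactHugging_of_tame_sep` / `_perfect`,
the slab kernels
`noTowerTameSep_of_contact` / `_of_not_contact`, `noTowerTamePerfect_of_contactPerfect`; §45 kernels: `offLocus_iff_cells_g21`,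
`tameSepOffLocus_of_contact`, `offLocus_iff_g21`, `nonPrincipal_iff_g21`, `wildHugging_iff_g21` (31572 hypothesis-free),
`tameInsep…_of_imperfect`, `tamePerfect…_of_contactPerfect`, `singularSurface_iff_g21`, `ftt_step_of_g21`.

[WRITER NOTE (decomp-res writer g6): namespace `…Theorems.HugValuationCut` as the whole lens-4 chain; split by the
critic's order into
`TameCutClasses` (cone-free: §43 axes, §45 cell classes, §46 all-weights classes, §47 arithmetic certificate —
the g20 arithmetic
file the critic names for §47 is not in the tree yet), `TameCutKernels` (cone-free: §44 the tame contact theorem +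
the §45 kernels /
EXACT re-locations at weight `n`) and `MaxContactCutTameCut` (inside the Theses cone: §46 BY-NAME wiring).  Nothing
else changed.]

(Sources: Giraud1975; EncinasVillamayor2000 Thm. 4.9; BravoGarciaEscamillaVillamayor2012 Lemma 4.6; EGAIV4 §16.8,
Thm. 16.11.2; StacksProject 00TV, 0BIQ; Liu2002 Thm. 8.1.19; BierstoneGrigorievMilmanWlodarczyk2011 §3, Lemma
3.6.2; Kollar2007 3.57; CossartJannsenSaito2020; CossartPiltant2019; Cutkosky2009 Thm. 5.1; Moh1987.)
-/

noncomputable section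

open CategoryTheory AlgebraicGeometry IsLocalRing
open Literature.AlgebraicGeometry.Resolution
open Summit.ResolutionOfSingularities.ResolutionOfSingularities.Theorems
open WeakOrderReduction ForcedTowerClasses DivergentTowerClasses MonomialTowerClasses
open HugDimensionClasses HugDimensionKernels SurfaceShadowClasses SurfaceShadowKernels
open ContactShadowClasses (NoTowerImperfect ContactShadow TowerObstructsAll ContactPerfect)
open ContactShadowKernels (noTowerImperfect_of_noTower noTowerImperfect_mono noTower_iff_columns)
open NearPointCut (SingularClass singularSurface_iff_noTower)
open AbsoluteContactClasses (IsAbsContactAt SepResidueAt AbsInv absInv_point hsPortSepResidue sepResidueAt_of_perfectField not_perfectField_of_not_sepResidueAt diffIdeal_restrict_le)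

namespace Summit.ResolutionOfSingularities.ResolutionOfSingularities.Theorems.HugValuationCut

/-! ## §44 (g21 · NEW · KERNEL, hypothesis-free, standard axioms) THE TAME CONTACT THEOREM along lens-4's `ForcedTower` -/

section TowerKernel

variable {k : Type} [Field k]

/-- **Every stage of a forced tower with a base root is locally Noetherian and REGULAR** (induction: blow-ups of
locally Noetherian schemes are locally Noetherian; the blow-up of a regular scheme in a regular centre is regular —
tree `IsBlowup.isLocallyNoetherian`, `IsBlowup.isRegular_of_isRegular_subscheme`). (Sources: Liu2002, Thm. 8.1.19;
StacksProject, Tag 02NS.) -/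
theorem tower_isLocallyNoetherian_isRegular (T : ForcedTower) (g : T.St 0 ⟶ Spec (.of k)) (hB : IsBase (T.St 0) g) :
    ∀ i, IsLocallyNoetherian (T.St i) ∧ Scheme.IsRegular (T.St i) := by
  intro i
  induction i with
  | zero =>
    haveI : LocallyOfFiniteType g := hB.locallyOfFiniteType
    exact ⟨LocallyOfFiniteType.isLocallyNoetherian g, hB.isRegular⟩
  | succ i ih =>
    haveI := ih.1
    exact ⟨(T.isBlowup i).isLocallyNoetherian,
      IsBlowup.isRegular_of_isRegular_subscheme ih.2 (T.centre_regular i) (T.isBlowup i)⟩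

/-- The root of a forced tower with a base is a Noetherian scheme (finite type and quasi-compact over a field). [folklore] -/
theorem tower_isNoetherian_root (T : ForcedTower) (g : T.St 0 ⟶ Spec (.of k)) (hB : IsBase (T.St 0) g) :
    IsNoetherian (T.St 0) := by
  haveI : LocallyOfFiniteType g := hB.locallyOfFiniteType
  haveI := LocallyOfFiniteType.isLocallyNoetherian g
  haveI : QuasiCompact g := hB.quasiCompact
  haveI : CompactSpace ↥(Spec (.of k)) := inferInstance
  haveI : CompactSpace ↥(T.St 0) := QuasiCompact.compactSpace_of_compactSpace g
  exact {}

/-- **The weight is constant along the tower** (the BGMW transform keeps the marking). [folklore] -/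
theorem tower_mult_eq (T : ForcedTower) {n : ℕ} (hD : IsDatum n (T.D 0)) : ∀ i, (T.D i).mult = n := by
  intro i
  induction i with
  | zero => exact hD.1
  | succ i ih => rw [T.transform_eq i, MarkedIdeal.transform_mult, ih]

/-- **`I_i,x_i ⊆ 𝔪_{x_i}^n` at every stage** (`x_i` lies in the support of the weight-`n` datum). [folklore] -/
theorem tower_stalkIdeal_le_pow (T : ForcedTower) {n : ℕ} (hD : IsDatum n (T.D 0)) (i : ℕ) :
    stalkIdeal (T.D i).ideal (T.pt i) ≤ maximalIdeal ((T.St i).presheaf.stalk (T.pt i)) ^ n := by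
  have h := (MarkedIdeal.mem_support_iff (T.D i) (T.pt i)).mp (T.isolated i).1
  rwa [tower_mult_eq T hD i] at h

/-- **One blow-up of the forced tower preserves the absolute-contact invariant** `AbsInv` (weight `N + 1`): the
tree's scheme-level point round `absInv_point` (chart computation + Giraud's lemma over `ℤ`) at the centre `{x_i}`.
(Sources: EncinasVillamayor2000, Thm. 4.9; BravoGarciaEscamillaVillamayor2012, Lemma 4.6; StacksProject, Tag 0BIQ.) -/
theorem tower_absInv_succ (T : ForcedTower) (g : T.St 0 ⟶ Spec (.of k)) (hB : IsBase (T.St 0) g) {N : ℕ}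
    (hD : IsDatum (N + 1) (T.D 0)) (i : ℕ) (H : (T.St i).IdealSheafData) (h : AbsInv (T.D i).ideal H N (T.pt i)) :
    AbsInv (T.D (i + 1)).ideal (strictTransformIdeal (T.π i) (T.centre i) H) N (T.pt (i + 1)) := by
  obtain ⟨hNi, hRi⟩ := tower_isLocallyNoetherian_isRegular T g hB i
  obtain ⟨hNi1, -⟩ := tower_isLocallyNoetherian_isRegular T g hB (i + 1)
  haveI := hNi
  haveI := hNi1
  have hπ := T.isBlowup i
  have hy : (T.π i).base (T.pt (i + 1)) = T.pt i := T.pt_map i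
  have hDi1 : (T.D (i + 1)).ideal = controlledTransform (T.π i) (T.centre i) (T.D i).ideal (N + 1) := by
    rw [T.transform_eq i, MarkedIdeal.transform_ideal, tower_mult_eq T hD i]
  rw [hDi1]
  have h' : AbsInv (T.D i).ideal H N ((T.π i).base (T.pt (i + 1))) := by rw [hy]; exact h
  have hIn : stalkIdeal (T.D i).ideal ((T.π i).base (T.pt (i + 1))) ≤ maximalIdeal _ ^ (N + 1) := by
    rw [hy]; exact tower_stalkIdeal_le_pow T hD i
  have hI'n : stalkIdeal (controlledTransform (T.π i) (T.centre i) (T.D i).ideal (N + 1)) (T.pt (i + 1)) ≤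
      maximalIdeal _ ^ (N + 1) := by
    have := tower_stalkIdeal_le_pow T hD (i + 1)
    rwa [hDi1] at this
  have hpt' : ((T.centre i).support : Set (T.St i)) = {(T.π i).base (T.pt (i + 1))} := by
    rw [hy]; exact T.centre_support i
  have hcl : IsClosed ({(T.π i).base (T.pt (i + 1))} : Set (T.St i)) := by rw [hy]; exact T.isClosed_pt i
  exact absInv_point hπ hRi (T.centre_regular i) _ H N _ hcl hpt' hIn hI'n h'

/-- **KERNEL (PROVED): GIRAUD PERSISTENCE ALONG THE FORCED TOWER** — the invariant `AbsInv` (the strict transform of `H`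
is a regular hypersurface germ cut out by an absolute `Diff^{≤N}_ℤ`-contact element of the weight-`(N+1)` datum) holds at
EVERY stage once it holds at the root. (Sources: EncinasVillamayor2000, Thm. 4.9; Giraud1975.) -/
theorem tower_absInv_strictIter (T : ForcedTower) (g : T.St 0 ⟶ Spec (.of k)) (hB : IsBase (T.St 0) g) {N : ℕ}
    (hD : IsDatum (N + 1) (T.D 0)) (H : (T.St 0).IdealSheafData) (h0 : AbsInv (T.D 0).ideal H N (T.pt 0)) :
    ∀ j, AbsInv (T.D (0 + j)).ideal (strictIter T 0 H j) N (T.pt (0 + j)) := by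
  intro j
  induction j with
  | zero => exact h0
  | succ j ih => exact tower_absInv_succ T g hB hD (0 + j) (strictIter T 0 H j) ih

/-- **KERNEL (PROVED): ABSOLUTE CONTACT AT A TAME SEPARABLE-RESIDUE POINT** — on a base of the class, at a closed point `y`
with separable residue field, an ideal of order EXACTLY `n` with `p ∤ n` has an absolute (`ℤ`-linear, order `≤ n − 1`)
contact element `u ∈ Diff^{≤n−1}_ℤ(𝓘_y) ∩ (𝔪_y ∖ 𝔪_y²)`: the tree's PROVED tame Hasse lemma
`hsPortSepResidue` and
restriction of scalars. (Sources: EGAIV4, Thm. 16.11.2; StacksProject, Tag 00TV; VillamayorU2008ReesDiff, §4.1.) -/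
theorem isAbsContactAt_of_tame_sep {p : ℕ} (hp : p.Prime) {K : Type} [Field K] [CharP K p] {Y : Scheme.{0}}
    (g : Y ⟶ Spec (.of K)) (hB : IsBase Y g) (I : Y.IdealSheafData) {n : ℕ} {y : Y} (hy : IsClosed ({y} : Set Y))
    (hsep : SepResidueAt g y) (hord : idealOrder I y = ((n : ℕ) : ℕ∞)) (hpn : ¬ p ∣ n) : IsAbsContactAt I n y := by
  obtain ⟨N, rfl⟩ : ∃ N, n = N + 1 :=
    ⟨n - 1, by have : n ≠ 0 := fun h => hpn (h ▸ dvd_zero p); omega⟩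
  have hle : stalkIdeal I y ≤ maximalIdeal (Y.presheaf.stalk y) ^ (N + 1) := (le_idealOrder_iff I y (N + 1)).mp hord.ge
  have hnle : ¬ stalkIdeal I y ≤ maximalIdeal (Y.presheaf.stalk y) ^ (N + 2) := by
    intro h
    have h1 := (le_idealOrder_iff I y (N + 2)).mpr h
    rw [hord] at h1
    exact absurd (ENat.coe_le_coe.mp h1) (by omega)
  obtain ⟨h, hhI, hh2⟩ : ∃ h ∈ stalkIdeal I y, h ∉ maximalIdeal (Y.presheaf.stalk y) ^ (N + 2) := by
    by_contra hcon
    push Not at hcon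
    exact hnle hcon
  letI := stalkAlgebra (g.appTop.hom.comp (Scheme.ΓSpecIso (.of K)).inv.hom) y
  obtain ⟨D, hD, hz⟩ := hsPortSepResidue p hp K Y g hB y hy hsep N h (hle hhI) hh2 hpn
  have hz1 := (adicOrder_eq_one_iff (D h)).mp hz
  have hDh : D h ∈ diffIdeal K N (stalkIdeal I y) := apply_mem_diffIdeal K hD hhI
  refine ⟨D h, ?_, hz1.1, hz1.2⟩
  rw [Nat.add_sub_cancel]
  exact diffIdeal_restrict_le N _ hDh

/-- **KERNEL (PROVED): an absolute contact element at the ROOT makes the forced tower a CONTACT tower** — spread the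
element to an ideal sheaf (tree `centreSpread`), persist (`tower_absInv_strictIter`), read off `ContactHugging`.
(Sources: Giraud1975; EncinasVillamayor2000, Thm. 4.9.) -/
theorem contactHugging_of_isAbsContactAt_root (T : ForcedTower) (g : T.St 0 ⟶ Spec (.of k)) (hB : IsBase (T.St 0) g)
    {N : ℕ} (hD : IsDatum (N + 1) (T.D 0)) (habs : IsAbsContactAt (T.D 0).ideal (N + 1) (T.pt 0)) :
    ContactHugging T := by
  obtain ⟨u, hu, hum, hu2⟩ := habs
  rw [Nat.add_sub_cancel] at hu
  haveI := tower_isNoetherian_root T g hB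
  have hu0 : u ≠ 0 := fun h => hu2 (by rw [h]; exact zero_mem _)
  have hspan : Ideal.span (Set.range fun _ : Fin 1 => u) = Ideal.span {u} := by rw [Set.range_const]
  obtain ⟨H, -, -, hHst⟩ := FInjectiveMacaulayfication.CentreSpread.centreSpread (T.St 0) (T.pt 0) 1 (fun _ => u)
      (by rw [hspan, Ne, Ideal.span_singleton_eq_bot]; exact hu0)
      (by rw [hspan]; exact (Ideal.span_singleton_le_iff_mem _).mpr hum)
  rw [hspan] at hHst
  have hinv := tower_absInv_strictIter T g hB hD H ⟨u, hHst, hu, hum, hu2⟩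
  have hord1 : idealOrder H (T.pt 0) = 1 := by
    refine le_antisymm ?_ ?_
    · by_contra hlt
      rw [not_le] at hlt
      have h2 : ((2 : ℕ) : ℕ∞) ≤ idealOrder H (T.pt 0) := by
        have : (1 : ℕ∞) + 1 ≤ idealOrder H (T.pt 0) := (ENat.add_one_le_iff (ENat.coe_ne_top 1)).mpr hlt
        exact_mod_cast this
      rw [le_idealOrder_iff, hHst] at h2
      exact hu2 (h2 (Ideal.mem_span_singleton_self u))
    · rw [show (1 : ℕ∞) = ((1 : ℕ) : ℕ∞) from rfl, le_idealOrder_iff, hHst, pow_one]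
      exact (Ideal.span_singleton_le_iff_mem _).mpr hum
  refine ⟨0, H, hord1, ?_, fun j => ?_⟩
  · rw [hord1]; exact ENat.coe_ne_top 1
  · obtain ⟨z, hHz, -, hzm, -⟩ := hinv j
    exact (mem_support_iff_stalkIdeal_le _ _).mpr (by rw [hHz]; exact (Ideal.span_singleton_le_iff_mem _).mpr hzm)

/-- **THE TAME CONTACT THEOREM (KERNEL, PROVED, hypothesis-free): a forced tower of weight `n` prime to `p` whose root
point has separable residue field hugs a regular hypersurface germ for ever.** (Sources: Giraud1975; EncinasVillamayor2000,
Thm. 4.9; EGAIV4, Thm. 16.11.2; BierstoneGrigorievMilmanWlodarczyk2011, Lemma 3.6.2.) -/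
theorem contactHugging_of_tame_sep {p : ℕ} (hp : p.Prime) {n : ℕ} (hpn : ¬ p ∣ n) {K : Type} [Field K] [CharP K p]
    (T : ForcedTower) (g : T.St 0 ⟶ Spec (.of K)) (hB : IsBase (T.St 0) g) (hD : IsDatum n (T.D 0))
    (hsep : SepResidueAt g (T.pt 0)) : ContactHugging T := by
  obtain ⟨N, rfl⟩ : ∃ N, n = N + 1 :=
    ⟨n - 1, by have : n ≠ 0 := fun h => hpn (h ▸ dvd_zero p); omega⟩
  have hge : (((N + 1 : ℕ) : ℕ) : ℕ∞) ≤ idealOrder (T.D 0).ideal (T.pt 0) := by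
    have h : ((T.D 0).mult : ℕ∞) ≤ idealOrder (T.D 0).ideal (T.pt 0) := (T.isolated 0).1
    rwa [hD.1] at h
  have hord : idealOrder (T.D 0).ideal (T.pt 0) = (((N + 1 : ℕ) : ℕ) : ℕ∞) := le_antisymm (hD.2 (T.pt 0)) hge
  exact contactHugging_of_isAbsContactAt_root T g hB hD
    (isAbsContactAt_of_tame_sep hp g hB (T.D 0).ideal (T.isClosed_pt 0) hsep hord hpn)

/-- **THE TAME CONTACT THEOREM over a PERFECT field** (the separability binder is automatic at the closed root
point). [folklore] -/
theorem contactHugging_of_tame_perfect {p : ℕ} (hp : p.Prime) {n : ℕ} (hpn : ¬ p ∣ n) {K : Type} [Field K] [CharP K p]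
    [PerfectField K] (T : ForcedTower) (g : T.St 0 ⟶ Spec (.of K)) (hB : IsBase (T.St 0) g) (hD : IsDatum n (T.D 0)) :
    ContactHugging T := by
  haveI : LocallyOfFiniteType g := hB.locallyOfFiniteType
  exact contactHugging_of_tame_sep hp hpn T g hB hD (sepResidueAt_of_perfectField g (T.isClosed_pt 0))

end TowerKernel

/-- **KERNEL: THE TAME–SEPARABLE SLAB OF EVERY CLASS IS A CONTACT SLAB** — it terminates as soon as the contact leaf
31571 does at the weight (no port). [folklore] -/
theorem noTowerTameSep_of_contact {n : ℕ} {P : ForcedTower → Prop} (h : ContactHuggingTowersTerminate n) :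
    NoTowerTameSep n P :=
  fun p hp hpn k _ _ T g hB hD hE hsep _ => h p hp k T g hB hD hE (contactHugging_of_tame_sep hp hpn T g hB hD hsep)

/-- **KERNEL: a class DISJOINT from contact has EMPTY tame–separable slab** (hypothesis-free). [folklore] -/
theorem noTowerTameSep_of_not_contact {n : ℕ} {P : ForcedTower → Prop} (hP : ∀ T, P T → ¬ ContactHugging T) :
    NoTowerTameSep n P :=
  fun _ hp hpn _ _ _ T g hB hD _ hsep hPT => hP T hPT (contactHugging_of_tame_sep hp hpn T g hB hD hsep)

/-- **KERNEL: over a PERFECT field the whole TAME slab of every class is a contact slab.** [folklore] -/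
theorem noTowerTamePerfect_of_contactPerfect {n : ℕ} {P : ForcedTower → Prop} (h : ContactPerfect n) :
    NoTowerTamePerfect n P :=
  fun p hp hpn k _ _ _ T g hB hD hE _ => h p hp k T g hB hD hE (contactHugging_of_tame_perfect hp hpn T g hB hD)

/-! ## §45 (g21 · NEW) kernels of the cells at weight `n`: EXACT re-locations, the tame–separable slabs ⊆
31571, the decided perfect cells -/

/-- Kernel (PROVED, pure logic): EXACT `(O) ⟺ (O,wild) ∧ (O,tame,sep) ∧ (O,tame,insep)`. [folklore] -/
theorem offLocus_iff_cells_g21 {n : ℕ} :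
    OffLocusShadowTowersTerminate n ↔ WildOffLocusTowersTerminate n ∧ TameSepOffLocusTowersTerminate n ∧
      TameInsepOffLocusTowersTerminate n :=
  noTower_iff_g21 _

/-- Kernel (PROVED, pure logic): EXACT `(L,¬P) ⟺ wild ∧ tame-sep ∧ tame-insep`. [folklore] -/
theorem nonPrincipal_iff_cells_g21 {n : ℕ} :
    NonPrincipalInLocusTowersTerminate n ↔ WildNonPrincipalInLocusTowersTerminate n ∧
      TameSepNonPrincipalInLocusTowersTerminate n ∧ TameInsepNonPrincipalInLocusTowersTerminate n :=
  noTower_iff_g21 _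

/-- **KERNEL: (O, tame, separable root) terminates as soon as 31571 does at weight `n`.** [folklore] -/
theorem tameSepOffLocus_of_contact {n : ℕ} (h : ContactHuggingTowersTerminate n) : TameSepOffLocusTowersTerminate n :=
  noTowerTameSep_of_contact h

/-- **KERNEL: (L,¬P, tame, separable root) terminates as soon as 31571 does at weight `n`.** [folklore] -/
theorem tameSepNonPrincipal_of_contact {n : ℕ} (h : ContactHuggingTowersTerminate n) :
    TameSepNonPrincipalInLocusTowersTerminate n :=
  noTowerTameSep_of_contact h

/-- **KERNEL (hypothesis-free): the tame–separable slab of the WILD LEAF 31572 is EMPTY.** [folklore] -/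
theorem tameSepWildHugging_empty {n : ℕ} : NoTowerTameSep n fun T => GermHugging T ∧ ¬ ContactHugging T :=
  noTowerTameSep_of_not_contact fun _ h => h.2

/-- **EXACT RE-LOCATION OF (O) given 31571 at the weight: `(O) ⟺ (O,wild) ∧ (O,tame,insep)`.** [folklore] -/
theorem offLocus_iff_g21 {n : ℕ} (h : ContactHuggingTowersTerminate n) :
    OffLocusShadowTowersTerminate n ↔ WildOffLocusTowersTerminate n ∧ TameInsepOffLocusTowersTerminate n :=
  offLocus_iff_cells_g21.trans ⟨fun h' => ⟨h'.1, h'.2.2⟩, fun h' => ⟨h'.1, tameSepOffLocus_of_contact h, h'.2⟩⟩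

/-- **EXACT RE-LOCATION OF (L,¬P) given 31571 at the weight.** [folklore] -/
theorem nonPrincipal_iff_g21 {n : ℕ} (h : ContactHuggingTowersTerminate n) :
    NonPrincipalInLocusTowersTerminate n ↔ WildNonPrincipalInLocusTowersTerminate n ∧
      TameInsepNonPrincipalInLocusTowersTerminate n :=
  nonPrincipal_iff_cells_g21.trans ⟨fun h' => ⟨h'.1, h'.2.2⟩, fun h' => ⟨h'.1, tameSepNonPrincipal_of_contact h, h'.2⟩⟩

/-- **EXACT CUT OF THE WILD LEAF 31572 at weight `n`, hypothesis-free: `WildHugging ⟺ (wild weight) ∧ (tame, insep root)`**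
— an infinite wild-hugging tower has `p ∣ n` or an inseparable root point. [folklore] -/
theorem wildHugging_iff_g21 {n : ℕ} :
    WildHuggingTowersTerminate n ↔ WildWildHuggingTowersTerminate n ∧ TameInsepWildHuggingTowersTerminate n :=
  (noTower_iff_g21 _).trans ⟨fun h => ⟨h.1, h.2.2⟩, fun h => ⟨h.1, tameSepWildHugging_empty, h.2⟩⟩

/-- the located cells lie in the imperfect column: (O, tame, insep). [folklore] -/
theorem tameInsepOffLocus_of_imperfect {n : ℕ}
    (h : NoTowerImperfect n fun T => SingularClass T ∧ Nonempty (MarkedShadow T n)) :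
    TameInsepOffLocusTowersTerminate n :=
  noTowerTameInsep_of_imperfect h

/-- the located cells lie in the imperfect column: (L,¬P, tame, insep). [folklore] -/
theorem tameInsepNonPrincipal_of_imperfect {n : ℕ}
    (h : NoTowerImperfect n fun T => SingularClass T ∧ InLocusShadow T ∧ ∀ S : HugShadow T, ¬ S.Principal) :
    TameInsepNonPrincipalInLocusTowersTerminate n :=
  noTowerTameInsep_of_imperfect h

/-- necessity, port-free: the cells are implied by their columns. [folklore] -/
theorem wildOffLocus_of_offLocus {n : ℕ} (h : OffLocusShadowTowersTerminate n) : WildOffLocusTowersTerminate n :=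
  noTowerWild_of_noTower h

/-- necessity, port-free. [folklore] -/
theorem tameInsepOffLocus_of_offLocus {n : ℕ} (h : OffLocusShadowTowersTerminate n) :
    TameInsepOffLocusTowersTerminate n :=
  noTowerTameInsep_of_noTower h

/-- necessity, port-free. [folklore] -/
theorem wildNonPrincipal_of_nonPrincipal {n : ℕ} (h : NonPrincipalInLocusTowersTerminate n) :
    WildNonPrincipalInLocusTowersTerminate n :=
  noTowerWild_of_noTower h

/-- necessity, port-free. [folklore] -/
theorem tameInsepNonPrincipal_of_nonPrincipal {n : ℕ} (h : NonPrincipalInLocusTowersTerminate n) :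
    TameInsepNonPrincipalInLocusTowersTerminate n :=
  noTowerTameInsep_of_noTower h

/-- **THE DECIDED CELL OVER PERFECT FIELDS · (O, tame, perfect) is EMPTY modulo the perfect contact column** (itself
EMPTY-MOD-PORT(KNOWN): `tamePerfectOffLocus_of_ports` in §46). [folklore] -/
theorem tamePerfectOffLocus_of_contactPerfect {n : ℕ} (h : ContactPerfect n) : TamePerfectOffLocusTowersTerminate n :=
  noTowerTamePerfect_of_contactPerfect h

/-- (L,¬P, tame, perfect) is EMPTY modulo the perfect contact column. [folklore] -/
theorem tamePerfectNonPrincipal_of_contactPerfect {n : ℕ} (h : ContactPerfect n) :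
    TamePerfectNonPrincipalInLocusTowersTerminate n :=
  noTowerTamePerfect_of_contactPerfect h

/-- **EXACT at weight `n` (tree g19 ports + lower weights + 31571 at the weight): 32260 at `n` ⟺ (O,wild) ∧
(O,tame,insep) ∧
(L,¬P,wild) ∧ (L,¬P,tame,insep) ∧ (L,P,pure) ∧ (L,P,drift,wild,incomm · IMPERFECT k).** [folklore] -/
theorem singularSurface_iff_g21 {n : ℕ} (hP : ShadowPort n) (hM : MarkingPort n) (hDesc : DescentPort n)
    (hFC : FactorContactPort n) (hCo : CouplingPort n) (hRi : RiderPort n)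
    (hlow : ∀ n' : ℕ, 1 ≤ n' → n' < n → ForcedTowersTerminate n') (h71 : ContactHuggingTowersTerminate n) :
    SingularSurfaceHuggingTowersTerminate n ↔ WildOffLocusTowersTerminate n ∧ TameInsepOffLocusTowersTerminate n ∧
      WildNonPrincipalInLocusTowersTerminate n ∧ TameInsepNonPrincipalInLocusTowersTerminate n ∧
        PurePrincipalTowersTerminate n ∧ IncommensurableWildDriftingImperfectTowersTerminate n :=
  (singularSurface_iff_g19 hP hM hDesc hFC hCo hRi hlow).trans
    ⟨fun h => ⟨wildOffLocus_of_offLocus h.1, tameInsepOffLocus_of_offLocus h.1, wildNonPrincipal_of_nonPrincipal h.2.1,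
        tameInsepNonPrincipal_of_nonPrincipal h.2.1, h.2.2.1, h.2.2.2⟩,
      fun h => ⟨(offLocus_iff_g21 h71).mpr ⟨h.1, h.2.1⟩, (nonPrincipal_iff_g21 h71).mpr ⟨h.2.2.1, h.2.2.2.1⟩,
        h.2.2.2.2.1, h.2.2.2.2.2⟩⟩

/-- **KERNEL — the ROOT PIECE at weight `n`** from the g21 cells, 31571 at the weight, the ports and all lower
weights. [folklore] -/
theorem ftt_step_of_g21 {n : ℕ} (hn : 1 ≤ n) (hMo : MonomialCorner n) (hC : CurveLaw n) (hSL : SurfaceLaw n)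
    (hH : HypersurfaceHuggingTowersTerminate n) (hP : ShadowPort n) (hM : MarkingPort n) (hDesc : DescentPort n)
    (hFC : FactorContactPort n) (hCo : CouplingPort n) (hRi : RiderPort n) (h71 : ContactHuggingTowersTerminate n)
    (hWO : WildOffLocusTowersTerminate n) (hTO : TameInsepOffLocusTowersTerminate n)
    (hWN : WildNonPrincipalInLocusTowersTerminate n) (hTN : TameInsepNonPrincipalInLocusTowersTerminate n)
    (hPu : PurePrincipalTowersTerminate n) (hR : IncommensurableWildDriftingImperfectTowersTerminate n)
    (hlow : ∀ n' : ℕ, 1 ≤ n' → n' < n → ForcedTowersTerminate n') : ForcedTowersTerminate n :=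
  ftt_step_of_g19 hn hMo hC hSL hH hP hM hDesc hFC hCo hRi ((offLocus_iff_g21 h71).mpr ⟨hWO, hTO⟩)
    ((nonPrincipal_iff_g21 h71).mpr ⟨hWN, hTN⟩) hPu hR hlow

end Summit.ResolutionOfSingularities.ResolutionOfSingularities.Theorems.HugValuationCut
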